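import Literature.Analysis.ValidatedNumerics.TaylorModelContract
import Literature.Analysis.ValidatedNumerics.TaylorModelL2
import Literature.Analysis.ValidatedNumerics.TaylorModelExp
import HarnessLib

/-!
# Partial panels: `∫_{-h}^{τρ} K(u) f(ρ + σu) du` as a Taylor model in `ρ`

Trunk T-ANA (Analysis/ValidatedNumerics); namespace `Literature.Analysis.ValidatedNumerics.PolyMP`.  Sequel of
`TaylorModelContract.lean`.  On the ONE panel of a moving integral that contains the moving endpoint, the integral of a kernel
`K` (panel Taylor model `W`, rational reference polynomial `pw`, `δ = tabsI(W − pw)`) against a shifted table function `f`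
(`TabOK S R f Atr e sup`, `2h ≤ R`) from `-h` to `τρ` (`σ, τ = ±1`) is a Taylor model in `ρ` on `|ρ| ≤ h`:

* `partVarI` — the exact part `∫_{-h}^{τρ} pw(u) P(ρ+σu) du` (`P` the table polynomial) organised as a moment contraction
  (`contrI` against `ν_b = Σ_j pw_j (−(−h)^{b+j+1})/(b+j+1)`) plus the rows `ρ^{j+1} Σ_r a_r · pw_j τ^{j+1} T(r,j)`,
  `T(r,j) = Σ_{b≤r} C(r,b)(στ)^b/(b+j+1)` (`evalR_partVar`); `tmem_partVar` adds the two error terms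
  `e·μ₀⁺/S` (`K ≥ 0`, `μ₀ ∋ ∫_{-h}^{h} K`) and `2h·δ·sup/S`;
* `partConstPoly` / `partConstI` / `tmem_partConst` — `ρ ↦ ∫_{-h}^{τρ} K(u) du` (the factor of the `g(y)`-terms).

Integer interval arithmetic plus small exact rationals only.  Problem-independent; no facts, no axioms.

## References

* K. Makino, M. Berz, Int. J. Pure Appl. Math. 4 (2003) 379–456, §6. [folklore]
-/

open MeasureTheory intervalIntegral Set Finset

namespace Literature.Analysis.ValidatedNumerics

namespace PolyMP

open Literature.Analysis.ValidatedNumerics.NumericsMP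
open Literature.Analysis.ValidatedNumerics.ExpPoly (Poly)
open Literature.Analysis.ValidatedNumerics.ExpPoly

/-! ## Algebraic helpers -/

/-- Triangle reindexing: `Σ_{a<n} Σ_{b<n−a} F a b = Σ_{r<n} Σ_{b≤r} F (r−b) b`. [folklore] -/
theorem sum_range_triangle {M : Type*} [AddCommMonoid M] (F : ℕ → ℕ → M) :
    ∀ n : ℕ, ∑ a ∈ range n, ∑ b ∈ range (n - a), F a b = ∑ r ∈ range n, ∑ b ∈ range (r + 1), F (r - b) b
  | 0 => by simp
  | n + 1 => by
      rw [Finset.sum_range_succ (fun r => ∑ b ∈ range (r + 1), F (r - b) b), ← sum_range_triangle F n,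
        Finset.sum_range_succ, Nat.add_sub_cancel_left, Finset.sum_range_one]
      have h1 : ∑ a ∈ range n, ∑ b ∈ range (n + 1 - a), F a b =
          ∑ a ∈ range n, ∑ b ∈ range (n - a), F a b + ∑ a ∈ range n, F a (n - a) := by
        rw [← Finset.sum_add_distrib]
        refine Finset.sum_congr rfl fun a ha => ?_
        rw [show n + 1 - a = (n - a) + 1 by have := Finset.mem_range.1 ha; omega, Finset.sum_range_succ]
      rw [h1, Finset.sum_range_succ' (fun b => F (n - b) b), Nat.sub_zero, add_assoc]
      congr 2
      conv_lhs => rw [← Finset.sum_range_reflect]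
      refine Finset.sum_congr rfl fun b hb => ?_
      have := Finset.mem_range.1 hb
      congr 1 <;> omega

/-- `evalR (0,…,0, l) x = x^k · evalR l x`. [folklore] -/
theorem evalR_replicate_append (k : ℕ) (l : List ℝ) (x : ℝ) :
    evalR (List.replicate k 0 ++ l) x = x ^ k * evalR l x := by
  induction k with
  | zero => simp
  | succ k ih => rw [List.replicate_succ, List.cons_append, evalR_cons, ih]; ring

/-- `PMem` of a list of zeros. [folklore] -/
theorem pmem_replicate_zero (S : ℕ) : ∀ k : ℕ, PMem S (List.replicate k (0 : ℝ)) (List.replicate k (MI.ofScaled 0))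
  | 0 => pmem_nil S
  | k + 1 => by simpa [List.replicate_succ] using pmem_cons (mem_zero_ofScaled S) (pmem_replicate_zero S k)

/-- `PMem` is preserved by `++`. [folklore] -/
theorem pmem_append {S : ℕ} {bs : List ℝ} {Q : IPoly} (hb : PMem S bs Q) :
    ∀ {as : List ℝ} {P : IPoly}, PMem S as P → PMem S (as ++ bs) (P ++ Q)
  | _, _, List.Forall₂.nil => by simpa using hb
  | _, _, List.Forall₂.cons ha hP => by simpa using pmem_cons ha (pmem_append hb hP)

/-- `getD` of a list given coefficientwise on `range n`. [folklore] -/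
theorem getD_map_range {α : Type*} (n : ℕ) (c : ℕ → α) (d : α) {b : ℕ} (hb : b < n) :
    ((List.range n).map c).getD b d = c b := by
  rw [List.getD_eq_getElem?_getD, List.getElem?_map, List.getElem?_range hb]
  rfl

/-- `Poly.eval` as a finite sum of monomials. [folklore] -/
theorem poly_eval_eq_sum (p : Poly) (u : ℝ) : Poly.eval p u = ∑ j ∈ range p.length, (p.getD j 0 : ℝ) * u ^ j := by
  rw [Poly.eval_eq_evalR, evalR_eq_sum, List.length_map]
  refine Finset.sum_congr rfl fun j _ => ?_
  rw [List.getD_eq_getElem?_getD, List.getElem?_map, List.getD_eq_getElem?_getD]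
  cases p[j]? <;> simp

/-! ## The exact part -/

/-- `T(r, j) = Σ_{b ≤ r} C(r,b) s^b/(b+j+1)`. [folklore] -/
def tCoef (r j : ℕ) (s : ℤ) : ℚ :=
  (List.range (r + 1)).foldl (fun acc b => acc + (r.choose b : ℚ) * (s : ℚ) ^ b / (b + j + 1)) 0

/-- `ν_b = Σ_j pw_j (−(−h)^{b+j+1})/(b+j+1)`. [folklore] -/
def nuCoef (h : ℚ) (pw : Poly) (b : ℕ) : ℚ :=
  (List.range pw.length).foldl (fun acc j => acc + pw.getD j 0 * (-((-h) ^ (b + j + 1))) / (b + j + 1)) 0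

/-- A `foldl` sum over `range n` is the `Finset` sum. [folklore] -/
theorem foldl_add_eq_sum (x : ℕ → ℚ) :
    ∀ n : ℕ, (List.range n).foldl (fun acc b => acc + x b) 0 = ∑ b ∈ range n, x b
  | 0 => by simp
  | n + 1 => by rw [List.range_succ, List.foldl_append, List.foldl_cons, List.foldl_nil, foldl_add_eq_sum x n,
      Finset.sum_range_succ]

/-- [folklore] -/
theorem tCoef_eq (r j : ℕ) (s : ℤ) :
    (tCoef r j s : ℝ) = ∑ b ∈ range (r + 1), (r.choose b : ℝ) * (s : ℝ) ^ b / (b + j + 1) := by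
  unfold tCoef
  rw [foldl_add_eq_sum (fun b => (r.choose b : ℚ) * (s : ℚ) ^ b / (b + j + 1))]
  push_cast
  rfl

/-- [folklore] -/
theorem nuCoef_eq (h : ℚ) (pw : Poly) (b : ℕ) :
    (nuCoef h pw b : ℝ) = ∑ j ∈ range pw.length, (pw.getD j 0 : ℝ) * (-((-(h : ℝ)) ^ (b + j + 1))) / (b + j + 1) := by
  unfold nuCoef
  rw [foldl_add_eq_sum (fun j => pw.getD j 0 * (-((-h) ^ (b + j + 1))) / (b + j + 1))]
  push_cast
  rfl

/-- The row `ρ^{j+1} · Σ_r A_r · (pw_j τ^{j+1} T(r,j))`. [folklore] -/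
def partRowI (S : ℕ) (Atr : IPoly) (pw : Poly) (sgn τ : ℤ) (j : ℕ) : IPoly :=
  List.replicate (j + 1) (MI.ofScaled 0) ++
    (List.range Atr.length).map fun r =>
      MI.mul S (Atr.getD r default) (ofRat S (pw.getD j 0 * (τ : ℚ) ^ (j + 1) * tCoef r j (sgn * τ)))

/-- **`∫_{-h}^{τρ} pw(u) P(ρ+σu) du` as an interval polynomial in `ρ`** (exact bivariate integration). [folklore] -/
def partVarI (S : ℕ) (h : ℚ) (Atr : IPoly) (pw : Poly) (sgn τ : ℤ) : IPoly :=
  (List.range pw.length).foldl (fun acc j => addI acc (partRowI S Atr pw sgn τ j))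
    (contrI S Atr ((List.range Atr.length).map fun b => ofRat S (nuCoef h pw b)) sgn)

/-- Termwise integration of a triple sum of monomials. [folklore] -/
private theorem integral_triple_sum (n m : ℕ) (N : ℕ → ℕ) (c : ℕ → ℕ → ℕ → ℝ) (lo hi : ℝ) :
    ∫ u in lo..hi, ∑ a ∈ range n, ∑ b ∈ range (N a), ∑ j ∈ range m, c a b j * u ^ (b + j) =
      ∑ a ∈ range n, ∑ b ∈ range (N a), ∑ j ∈ range m, c a b j * ∫ u in lo..hi, u ^ (b + j) := by
  have hc : ∀ a b, Continuous fun u : ℝ => ∑ j ∈ range m, c a b j * u ^ (b + j) := fun a b =>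
    continuous_finsetSum _ fun j _ => continuous_const.mul (continuous_pow _)
  have hb : ∀ a, Continuous fun u : ℝ => ∑ b ∈ range (N a), ∑ j ∈ range m, c a b j * u ^ (b + j) := fun a =>
    continuous_finsetSum _ fun b _ => hc a b
  refine (intervalIntegral.integral_finsetSum fun a _ => (hb a).intervalIntegrable _ _).trans ?_
  refine Finset.sum_congr rfl fun a _ => ?_
  refine (intervalIntegral.integral_finsetSum fun b _ => (hc a b).intervalIntegrable _ _).trans ?_
  refine Finset.sum_congr rfl fun b _ => ?_
  refine (intervalIntegral.integral_finsetSum fun j _ =>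
    (continuous_const.mul (continuous_pow _)).intervalIntegrable _ _).trans ?_
  refine Finset.sum_congr rfl fun j _ => ?_
  exact intervalIntegral.integral_const_mul _ _

section Exact

variable {S : ℕ} (hS : 0 < S) {h : ℚ} {as : List ℝ} {Atr : IPoly} (has : PMem S as Atr) (pw : Poly) {sgn τ : ℤ}

/-- The real rows. [folklore] -/
private noncomputable def rowR (as : List ℝ) (pw : Poly) (sgn τ : ℤ) (n j : ℕ) : List ℝ :=
  List.replicate (j + 1) 0 ++
    (List.range n).map fun r => as.getD r 0 * ((pw.getD j 0 * (τ : ℚ) ^ (j + 1) * tCoef r j (sgn * τ) : ℚ) : ℝ)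

include hS has in
/-- [folklore] -/
private theorem pmem_rowR (j : ℕ) : PMem S (rowR as pw sgn τ Atr.length j) (partRowI S Atr pw sgn τ j) := by
  unfold rowR partRowI
  refine pmem_append ?_ (pmem_replicate_zero S (j + 1))
  have : ∀ l : List ℕ, (∀ r ∈ l, r < Atr.length) →
      PMem S (l.map fun r => as.getD r 0 * ((pw.getD j 0 * (τ : ℚ) ^ (j + 1) * tCoef r j (sgn * τ) : ℚ) : ℝ))
        (l.map fun r => MI.mul S (Atr.getD r default) (ofRat S (pw.getD j 0 * (τ : ℚ) ^ (j + 1) * tCoef r j (sgn * τ)))) := by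
    intro l hl
    induction l with
    | nil => exact pmem_nil S
    | cons r l ih =>
        simp only [List.map_cons]
        exact pmem_cons (MI.mem_mul hS (mem_getD_of_pmem has (hl r (by simp))) (mem_ofRat S _))
          (ih fun x hx => hl x (by simp [hx]))
  exact this _ fun r hr => List.mem_range.1 hr

/-- [folklore] -/
private theorem evalR_rowR (n j : ℕ) (ρ : ℝ) :
    evalR (rowR as pw sgn τ n j) ρ = ρ ^ (j + 1) * ∑ r ∈ range n,
      as.getD r 0 * ((pw.getD j 0 : ℝ) * (τ : ℝ) ^ (j + 1) * (tCoef r j (sgn * τ) : ℝ)) * ρ ^ r := by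
  unfold rowR
  rw [evalR_replicate_append, evalR_map_range]
  congr 1
  refine Finset.sum_congr rfl fun r _ => ?_
  push_cast
  ring

include hS has in
/-- **The exact partial-panel integral.**  For `as ∈ Atr`, there is a FIXED coefficient list in `partVarI …` whose value at every
`ρ` is `∫_{-h}^{τρ} pw(u) · P(ρ + σu) du`, `P = evalR as`. [folklore] -/
theorem evalR_partVar :
    ∃ cs : List ℝ, PMem S cs (partVarI S h Atr pw sgn τ) ∧ ∀ ρ : ℝ,
      ∫ u in (-(h : ℝ))..((τ : ℝ) * ρ), Poly.eval pw u * evalR as (ρ + sgn * u) = evalR cs ρ := by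
  set n := Atr.length with hn
  have hlen : as.length = n := has.length_eq
  set m := pw.length with hm
  -- part 1: the contraction against ν
  set nu : ℕ → ℝ := fun b => (nuCoef h pw b : ℝ) with hnu
  set cs1 : List ℝ := (List.range n).map fun a =>
      ∑ b ∈ range (n - a), as.getD (a + b) 0 * ((a + b).choose a : ℝ) * (sgn : ℝ) ^ b * nu b with hcs1
  have h1 : PMem S cs1 (contrI S Atr ((List.range Atr.length).map fun b => ofRat S (nuCoef h pw b)) sgn) := by
    rw [hcs1, hn]
    refine pmem_contrI hS has (m := nu) (fun b hb => ?_) sgn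
    rw [getD_map_range _ _ _ hb]
    exact mem_ofRat S _
  -- the rows, folded
  have hfold : ∀ k : ℕ, ∃ cs : List ℝ,
      PMem S cs ((List.range k).foldl (fun acc j => addI acc (partRowI S Atr pw sgn τ j))
        (contrI S Atr ((List.range Atr.length).map fun b => ofRat S (nuCoef h pw b)) sgn)) ∧
      ∀ ρ, evalR cs ρ = evalR cs1 ρ + ∑ j ∈ range k, evalR (rowR as pw sgn τ n j) ρ := by
    intro k
    induction k with
    | zero => exact ⟨cs1, h1, fun ρ => by simp⟩
    | succ k ih =>
        obtain ⟨cs, hcs, hev⟩ := ih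
        refine ⟨addR cs (rowR as pw sgn τ n k), ?_, fun ρ => ?_⟩
        · rw [List.range_succ, List.foldl_append, List.foldl_cons, List.foldl_nil]
          exact pmem_addI hcs (hn ▸ pmem_rowR hS has pw k)
        · rw [evalR_addR, hev, Finset.sum_range_succ, add_assoc]
  obtain ⟨cs, hcs, hev⟩ := hfold m
  refine ⟨cs, hcs, fun ρ => ?_⟩
  rw [hev ρ]
  -- expand the integrand
  set cf : ℕ → ℕ → ℕ → ℝ := fun a b j =>
    as.getD (a + b) 0 * ((a + b).choose a : ℝ) * (sgn : ℝ) ^ b * (pw.getD j 0 : ℝ) * ρ ^ a with hcf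
  have e1 : ∀ u : ℝ, Poly.eval pw u * evalR as (ρ + sgn * u) =
      ∑ a ∈ range n, ∑ b ∈ range (n - a), ∑ j ∈ range m, cf a b j * u ^ (b + j) := by
    intro u
    rw [poly_eval_eq_sum, evalR_add_eq_sum, hlen, ← hm, mul_comm, Finset.sum_mul]
    refine Finset.sum_congr rfl fun a _ => ?_
    simp only [Finset.mul_sum, Finset.sum_mul]
    rw [Finset.sum_comm]
    refine Finset.sum_congr rfl fun b _ => Finset.sum_congr rfl fun j _ => ?_
    simp only [hcf]
    rw [mul_pow, pow_add]
    ring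
  -- integrate termwise
  set Ik : ℕ → ℝ := fun k => (((τ : ℝ) * ρ) ^ (k + 1) - (-(h : ℝ)) ^ (k + 1)) / (k + 1) with hIk
  have e2 : ∫ u in (-(h : ℝ))..((τ : ℝ) * ρ), Poly.eval pw u * evalR as (ρ + sgn * u) =
      ∑ a ∈ range n, ∑ b ∈ range (n - a), ∑ j ∈ range m, cf a b j * Ik (b + j) := by
    rw [intervalIntegral.integral_congr fun u _ => e1 u]
    refine (integral_triple_sum n m (fun a => n - a) cf _ _).trans ?_
    refine Finset.sum_congr rfl fun a _ => Finset.sum_congr rfl fun b _ => Finset.sum_congr rfl fun j _ => ?_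
    rw [integral_pow]
  rw [e2]
  -- split `Ik = I⁺ − I⁻`
  have e3 : ∀ a b j, cf a b j * Ik (b + j) =
      cf a b j * ((τ : ℝ) * ρ) ^ (b + j + 1) / (b + j + 1) - cf a b j * (-(h : ℝ)) ^ (b + j + 1) / (b + j + 1) := by
    intro a b j; simp only [hIk]; push_cast; ring
  simp_rw [e3, Finset.sum_sub_distrib]
  -- the `I⁻` part is `-evalR cs1 ρ`
  have eB : ∑ a ∈ range n, ∑ b ∈ range (n - a), ∑ j ∈ range m, cf a b j * (-(h : ℝ)) ^ (b + j + 1) / (b + j + 1) =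
      -evalR cs1 ρ := by
    rw [hcs1, evalR_map_range, ← Finset.sum_neg_distrib]
    refine Finset.sum_congr rfl fun a _ => ?_
    rw [← neg_mul, ← Finset.sum_neg_distrib, Finset.sum_mul]
    refine Finset.sum_congr rfl fun b _ => ?_
    have hnub : nu b = ∑ j ∈ range m, (pw.getD j 0 : ℝ) * (-((-(h : ℝ)) ^ (b + j + 1))) / (b + j + 1) := by
      simp only [hnu]; rw [nuCoef_eq, ← hm]
    rw [hnub, Finset.mul_sum, ← Finset.sum_neg_distrib, Finset.sum_mul]
    refine Finset.sum_congr rfl fun j _ => ?_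
    simp only [hcf]
    ring
  -- the `I⁺` part is the sum of the rows
  have eA : ∑ a ∈ range n, ∑ b ∈ range (n - a), ∑ j ∈ range m, cf a b j * ((τ : ℝ) * ρ) ^ (b + j + 1) / (b + j + 1) =
      ∑ j ∈ range m, evalR (rowR as pw sgn τ n j) ρ := by
    -- bring `j` outside, then triangle-reindex `(a, b) ↦ (r, b)`
    have swap : ∑ a ∈ range n, ∑ b ∈ range (n - a), ∑ j ∈ range m,
        cf a b j * ((τ : ℝ) * ρ) ^ (b + j + 1) / (b + j + 1) =
        ∑ j ∈ range m, ∑ a ∈ range n, ∑ b ∈ range (n - a), cf a b j * ((τ : ℝ) * ρ) ^ (b + j + 1) / (b + j + 1) := by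
      rw [Finset.sum_comm]
      refine Finset.sum_congr rfl fun a _ => ?_
      rw [Finset.sum_comm]
    rw [swap]
    refine Finset.sum_congr rfl fun j _ => ?_
    rw [sum_range_triangle (fun a b => cf a b j * ((τ : ℝ) * ρ) ^ (b + j + 1) / (b + j + 1)) n, evalR_rowR,
      Finset.mul_sum]
    refine Finset.sum_congr rfl fun r hr => ?_
    rw [tCoef_eq]
    push_cast
    rw [Finset.mul_sum, Finset.mul_sum, Finset.sum_mul, Finset.mul_sum]
    refine Finset.sum_congr rfl fun b hb => ?_
    have hbr : b ≤ r := Nat.lt_succ_iff.1 (Finset.mem_range.1 hb)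
    simp only [hcf]
    rw [Nat.sub_add_cancel hbr, Nat.choose_symm hbr,
      show ρ ^ r = ρ ^ (r - b) * ρ ^ b by rw [← pow_add, Nat.sub_add_cancel hbr], mul_pow, mul_pow]
    ring
  rw [eA, eB]
  ring

end Exact



/-! ## The partial-panel Taylor model with the kernel -/

section Kernel

variable {S : ℕ} {h R : ℚ} {K f : ℝ → ℝ}

/-- Sub-interval integrability on `[-h, τρ] ⊆ [-h, h]`. [folklore] -/
theorem intervalIntegrable_sub_of_kernel (hK : IntervalIntegrable K volume (-(h : ℝ)) h) {g : ℝ → ℝ}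
    (hg : Continuous g) {v : ℝ} (hv1 : -(h : ℝ) ≤ v) (hv2 : v ≤ h) :
    IntervalIntegrable (fun u => K u * g u) volume (-(h : ℝ)) v :=
  (hK.mono_set (by rw [uIcc_of_le hv1, uIcc_of_le (hv1.trans hv2)]; exact Icc_subset_Icc le_rfl hv2)).mul_continuousOn
    hg.continuousOn

/-- **The partial-panel Taylor model.**  Kernel `K ≥ 0` on `[-h, h]` with panel model `W` and rational reference `pw`,
`μ₀ ∋ ∫_{-h}^{h} K`; `f` continuous with a local table on `|s| ≤ R`, `2h ≤ R`; `σ, τ = ±1`.  Then on `|ρ| ≤ h`,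
`∫_{-h}^{τρ} K(u) f(ρ+σu) du ∈ widen0 (partVarI S h Atr pw σ τ) ⌈(e μ₀⁺ + 2h·δ·sup)/S⌉`, `δ = tabsI(W − pw)`. [folklore] -/
theorem tmem_partVar (hS : 0 < S) (h0 : 0 ≤ h) (hR : 2 * h ≤ R) {Atr : IPoly} {e sup : ℤ}
    (hT : TabOK S R f Atr e sup) (hf : Continuous f) (hK : IntervalIntegrable K volume (-(h : ℝ)) h)
    (hK0 : ∀ u ∈ Icc (-(h : ℝ)) h, 0 ≤ K u) {W : IPoly} (hW : TMem S h K W) (pw : Poly) {mu0 : MI}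
    (hmu0 : MI.mem S (∫ u in (-(h : ℝ))..h, K u) mu0) {sgn τ : ℤ} (hsgn : sgn = 1 ∨ sgn = -1)
    (hτ : τ = 1 ∨ τ = -1) :
    TMem S h (fun ρ => ∫ u in (-(h : ℝ))..((τ : ℝ) * ρ), K u * f (ρ + sgn * u))
      (widen0 (partVarI S h Atr pw sgn τ)
        ⌈(((e * mu0.hi : ℤ) : ℚ) + 2 * h * ((tabsI S h (tsubI W (ratPolyI S pw)) * sup : ℤ) : ℚ)) / S⌉) := by
  obtain ⟨as, has, hrem, hsup⟩ := hT
  obtain ⟨cs, hcs, hev⟩ := evalR_partVar hS has pw (sgn := sgn) (τ := τ) (h := h)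
  intro ρ hρ
  have hhr : (0 : ℝ) ≤ h := by exact_mod_cast h0
  have hSr : (0 : ℝ) < S := by exact_mod_cast hS
  have hρ1 := (abs_le.1 hρ).1
  have hρ2 := (abs_le.1 hρ).2
  have hτabs : |(τ : ℝ)| = 1 := by rcases hτ with h1 | h1 <;> simp [h1]
  have hσabs : |(sgn : ℝ)| = 1 := by rcases hsgn with h1 | h1 <;> simp [h1]
  have hv1 : -(h : ℝ) ≤ τ * ρ := by rcases hτ with h1 | h1 <;> simp [h1] <;> linarith
  have hv2 : (τ : ℝ) * ρ ≤ h := by rcases hτ with h1 | h1 <;> simp [h1] <;> linarith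
  set P : ℝ → ℝ := fun s => evalR as s with hP
  have hPc : Continuous P := continuous_evalR as
  have hshift : Continuous fun u : ℝ => ρ + sgn * u := by fun_prop
  have harg : ∀ u ∈ Icc (-(h : ℝ)) h, |ρ + sgn * u| ≤ R := by
    intro u hu
    have hu' : |u| ≤ h := abs_le.2 ⟨hu.1, hu.2⟩
    have hR' : (2 : ℝ) * h ≤ R := by exact_mod_cast hR
    calc |ρ + sgn * u| ≤ |ρ| + |(sgn : ℝ) * u| := abs_add_le _ _
      _ = |ρ| + |u| := by rw [abs_mul, hσabs, one_mul]
      _ ≤ R := by linarith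
  -- the three integrands
  set F1 : ℝ → ℝ := fun u => Poly.eval pw u * P (ρ + sgn * u) with hF1
  set F2 : ℝ → ℝ := fun u => (K u - Poly.eval pw u) * P (ρ + sgn * u) with hF2
  set F3 : ℝ → ℝ := fun u => K u * (f (ρ + sgn * u) - P (ρ + sgn * u)) with hF3
  have hI1 : IntervalIntegrable F1 volume (-(h : ℝ)) (τ * ρ) :=
    ((Poly.continuous_eval pw).mul (hPc.comp hshift)).intervalIntegrable _ _
  have hIKP : IntervalIntegrable (fun u => K u * P (ρ + sgn * u)) volume (-(h : ℝ)) (τ * ρ) :=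
    intervalIntegrable_sub_of_kernel hK (hPc.comp hshift) hv1 hv2
  have hI2 : IntervalIntegrable F2 volume (-(h : ℝ)) (τ * ρ) := by
    have : F2 = fun u => K u * P (ρ + sgn * u) - F1 u := by funext u; simp only [hF2, hF1]; ring
    rw [this]; exact hIKP.sub hI1
  have hIKf : IntervalIntegrable (fun u => K u * f (ρ + sgn * u)) volume (-(h : ℝ)) (τ * ρ) :=
    intervalIntegrable_sub_of_kernel hK (hf.comp hshift) hv1 hv2
  have hI3 : IntervalIntegrable F3 volume (-(h : ℝ)) (τ * ρ) := by
    have : F3 = fun u => K u * f (ρ + sgn * u) - K u * P (ρ + sgn * u) := by funext u; simp only [hF3]; ring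
    rw [this]; exact hIKf.sub hIKP
  have hsplit : ∫ u in (-(h : ℝ))..((τ : ℝ) * ρ), K u * f (ρ + sgn * u) =
      (∫ u in (-(h : ℝ))..((τ : ℝ) * ρ), F1 u) + ((∫ u in (-(h : ℝ))..((τ : ℝ) * ρ), F2 u) +
        ∫ u in (-(h : ℝ))..((τ : ℝ) * ρ), F3 u) := by
    rw [← intervalIntegral.integral_add hI2 hI3, ← intervalIntegral.integral_add hI1 (hI2.add hI3)]
    exact intervalIntegral.integral_congr fun u _ => by simp only [hF1, hF2, hF3]; ring
  have hexact : ∫ u in (-(h : ℝ))..((τ : ℝ) * ρ), F1 u = evalR cs ρ := hev ρ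
  -- error 2: `(K − pw)·P`
  set δ : ℤ := tabsI S h (tsubI W (ratPolyI S pw)) with hδ
  have hE2 : |∫ u in (-(h : ℝ))..((τ : ℝ) * ρ), F2 u| ≤ 2 * h * ((δ : ℝ) / S) * ((sup : ℝ) / S) := by
    have hb : ∀ u ∈ Set.uIoc (-(h : ℝ)) (τ * ρ), ‖F2 u‖ ≤ (δ : ℝ) / S * ((sup : ℝ) / S) := by
      intro u hu
      have hu' : u ∈ Icc (-(h : ℝ)) h := by
        rw [uIoc_of_le hv1] at hu; exact ⟨hu.1.le, hu.2.trans hv2⟩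
      rw [Real.norm_eq_abs, hF2]
      simp only []
      rw [abs_mul]
      refine mul_le_mul (abs_sub_poly_le_of_tmem hS h0 hW pw (abs_le.2 ⟨hu'.1, hu'.2⟩)) ?_ (abs_nonneg _)
        ((abs_nonneg _).trans (abs_sub_poly_le_of_tmem hS h0 hW pw (abs_le.2 ⟨hu'.1, hu'.2⟩)))
      rw [le_div_iff₀ hSr]; exact hsup _ (harg u hu')
    have := intervalIntegral.norm_integral_le_of_norm_le_const hb
    rw [Real.norm_eq_abs] at this
    refine this.trans ?_
    have hlen : |(τ : ℝ) * ρ - -(h : ℝ)| ≤ 2 * h := by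
      rw [abs_le]; constructor <;> linarith
    have hnn : 0 ≤ (δ : ℝ) / S * ((sup : ℝ) / S) := by
      refine mul_nonneg (div_nonneg ?_ hSr.le) (div_nonneg ?_ hSr.le)
      · have := abs_sub_poly_le_of_tmem hS h0 hW pw (ρ := 0) (by rw [abs_zero]; exact hhr)
        have h' := (abs_nonneg _).trans this
        exact_mod_cast (div_nonneg_iff.1 h').elim (fun h => by exact_mod_cast h.1) fun h => by
          exfalso; linarith [h.2, hSr]
      · have := hsup 0 (by rw [abs_zero]; exact_mod_cast (le_trans (by linarith) hR))
        exact le_trans (by positivity) this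
    nlinarith
  -- error 3: `K·(f − P)`
  have hE3 : |∫ u in (-(h : ℝ))..((τ : ℝ) * ρ), F3 u| ≤ (e : ℝ) / S * ((mu0.hi : ℝ) / S) := by
    have he0 : (0 : ℝ) ≤ e := by
      have := hrem 0 (by rw [abs_zero]; exact_mod_cast le_trans (by linarith) hR)
      exact le_trans (by positivity) this
    have hKsub : IntervalIntegrable K volume (-(h : ℝ)) (τ * ρ) :=
      hK.mono_set (by rw [uIcc_of_le hv1, uIcc_of_le (hv1.trans hv2)]; exact Icc_subset_Icc le_rfl hv2)
    have h1 : |∫ u in (-(h : ℝ))..((τ : ℝ) * ρ), F3 u| ≤ ∫ u in (-(h : ℝ))..((τ : ℝ) * ρ), (e : ℝ) / S * K u := by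
      calc |∫ u in (-(h : ℝ))..((τ : ℝ) * ρ), F3 u| ≤ ∫ u in (-(h : ℝ))..((τ : ℝ) * ρ), |F3 u| :=
            intervalIntegral.abs_integral_le_integral_abs hv1
        _ ≤ ∫ u in (-(h : ℝ))..((τ : ℝ) * ρ), (e : ℝ) / S * K u := by
            refine intervalIntegral.integral_mono_on hv1 hI3.abs (hKsub.const_mul _) fun u hu => ?_
            have hu' : u ∈ Icc (-(h : ℝ)) h := ⟨hu.1, hu.2.trans hv2⟩
            rw [hF3]
            simp only []
            rw [abs_mul, abs_of_nonneg (hK0 u hu'), mul_comm]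
            refine mul_le_mul_of_nonneg_right ?_ (hK0 u hu')
            rw [le_div_iff₀ hSr]
            exact hrem _ (harg u hu')
    have h2 : ∫ u in (-(h : ℝ))..((τ : ℝ) * ρ), (e : ℝ) / S * K u ≤ (e : ℝ) / S * ∫ u in (-(h : ℝ))..h, K u := by
      rw [intervalIntegral.integral_const_mul]
      refine mul_le_mul_of_nonneg_left ?_ (by positivity)
      exact intervalIntegral.integral_mono_interval le_rfl hv1 hv2
        (MeasureTheory.ae_restrict_of_forall_mem measurableSet_Ioc fun u hu => hK0 u ⟨hu.1.le, hu.2⟩) hK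
    have h3 : (∫ u in (-(h : ℝ))..h, K u) ≤ (mu0.hi : ℝ) / S := by
      rw [le_div_iff₀ hSr]; exact hmu0.2
    calc |∫ u in (-(h : ℝ))..((τ : ℝ) * ρ), F3 u| ≤ (e : ℝ) / S * ∫ u in (-(h : ℝ))..h, K u := h1.trans h2
      _ ≤ (e : ℝ) / S * ((mu0.hi : ℝ) / S) := mul_le_mul_of_nonneg_left h3 (by positivity)
  -- assemble
  have herr : |(∫ u in (-(h : ℝ))..((τ : ℝ) * ρ), F2 u) + ∫ u in (-(h : ℝ))..((τ : ℝ) * ρ), F3 u| * S ≤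
      ((⌈(((e * mu0.hi : ℤ) : ℚ) + 2 * h * ((δ * sup : ℤ) : ℚ)) / S⌉ : ℤ) : ℝ) := by
    have hsum : |(∫ u in (-(h : ℝ))..((τ : ℝ) * ρ), F2 u) + ∫ u in (-(h : ℝ))..((τ : ℝ) * ρ), F3 u| * S ≤
        ((e : ℝ) * mu0.hi + 2 * h * (δ * sup)) / S := by
      have := mul_le_mul_of_nonneg_right ((abs_add_le _ _).trans (add_le_add hE2 hE3)) hSr.le
      refine this.trans (le_of_eq ?_)
      field_simp
      ring
    refine hsum.trans ?_
    have hc := (Rat.cast_le (K := ℝ)).2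
      (Int.le_ceil ((((e * mu0.hi : ℤ) : ℚ) + 2 * h * ((δ * sup : ℤ) : ℚ)) / S))
    push_cast at hc ⊢
    exact hc
  obtain ⟨bs, hbs, eb⟩ := exists_widen0 hcs herr ρ
  refine ⟨bs, hbs, ?_⟩
  beta_reduce
  rw [hsplit, hexact, eb]

/-! ## `ρ ↦ ∫_{-h}^{τρ} K(u) du` -/

/-- The exact polynomial `∫_{-h}^{τρ} pw(u) du` in `ρ`. [folklore] -/
def partConstPoly (h : ℚ) (pw : Poly) (τ : ℤ) : Poly :=
  ((List.range pw.length).foldl (fun acc j => acc + -(pw.getD j 0 * (-h) ^ (j + 1) / (j + 1))) 0) ::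
    (List.range pw.length).map fun j => pw.getD j 0 * (τ : ℚ) ^ (j + 1) / (j + 1)

/-- [folklore] -/
theorem eval_partConstPoly (h : ℚ) (pw : Poly) (τ : ℤ) (ρ : ℝ) :
    Poly.eval (partConstPoly h pw τ) ρ = ∫ u in (-(h : ℝ))..((τ : ℝ) * ρ), Poly.eval pw u := by
  have hI : ∫ u in (-(h : ℝ))..((τ : ℝ) * ρ), Poly.eval pw u =
      ∑ j ∈ range pw.length, (pw.getD j 0 : ℝ) * ((((τ : ℝ) * ρ) ^ (j + 1) - (-(h : ℝ)) ^ (j + 1)) / (j + 1)) := by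
    rw [intervalIntegral.integral_congr fun u _ => poly_eval_eq_sum pw u]
    refine (intervalIntegral.integral_finsetSum fun j _ =>
      (continuous_const.mul (continuous_pow _)).intervalIntegrable _ _).trans ?_
    refine Finset.sum_congr rfl fun j _ => ?_
    simp only [Pi.mul_apply]
    rw [intervalIntegral.integral_const_mul, integral_pow]
  rw [hI, partConstPoly, Poly.eval, foldl_add_eq_sum, poly_eval_eq_sum, List.length_map, List.length_range,
    Finset.mul_sum]
  push_cast
  rw [← Finset.sum_add_distrib]
  refine Finset.sum_congr rfl fun j hj => ?_
  rw [getD_map_range _ _ _ (Finset.mem_range.1 hj)]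
  push_cast
  rw [mul_pow]
  ring

/-- **`∫_{-h}^{τρ} K` as a Taylor model**: the exact polynomial of the reference `pw` widened by `2h · tabsI(W − pw)`.
[folklore] -/
def partConstI (S : ℕ) (h : ℚ) (W : IPoly) (pw : Poly) (τ : ℤ) : IPoly :=
  widen0 (ratPolyI S (partConstPoly h pw τ)) ⌈2 * h * (tabsI S h (tsubI W (ratPolyI S pw)) : ℚ)⌉

/-- [folklore] -/
theorem tmem_partConst {S : ℕ} (hS : 0 < S) {h : ℚ} (h0 : 0 ≤ h) {K : ℝ → ℝ}
    (hK : IntervalIntegrable K volume (-(h : ℝ)) h) {W : IPoly} (hW : TMem S h K W) (pw : Poly) {τ : ℤ}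
    (hτ : τ = 1 ∨ τ = -1) :
    TMem S h (fun ρ => ∫ u in (-(h : ℝ))..((τ : ℝ) * ρ), K u) (partConstI S h W pw τ) := by
  intro ρ hρ
  have hhr : (0 : ℝ) ≤ h := by exact_mod_cast h0
  have hSr : (0 : ℝ) < S := by exact_mod_cast hS
  have hρ1 := (abs_le.1 hρ).1
  have hρ2 := (abs_le.1 hρ).2
  have hv1 : -(h : ℝ) ≤ τ * ρ := by rcases hτ with h1 | h1 <;> simp [h1] <;> linarith
  have hv2 : (τ : ℝ) * ρ ≤ h := by rcases hτ with h1 | h1 <;> simp [h1] <;> linarith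
  have hKsub : IntervalIntegrable K volume (-(h : ℝ)) (τ * ρ) :=
    hK.mono_set (by rw [uIcc_of_le hv1, uIcc_of_le (hv1.trans hv2)]; exact Icc_subset_Icc le_rfl hv2)
  have hPi : IntervalIntegrable (fun u => Poly.eval pw u) volume (-(h : ℝ)) (τ * ρ) :=
    (Poly.continuous_eval pw).intervalIntegrable _ _
  have hsplit : ∫ u in (-(h : ℝ))..((τ : ℝ) * ρ), K u =
      (∫ u in (-(h : ℝ))..((τ : ℝ) * ρ), Poly.eval pw u) + ∫ u in (-(h : ℝ))..((τ : ℝ) * ρ), (K u - Poly.eval pw u) := by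
    rw [← intervalIntegral.integral_add hPi (hKsub.sub hPi)]
    exact intervalIntegral.integral_congr fun u _ => by ring
  set δ : ℤ := tabsI S h (tsubI W (ratPolyI S pw)) with hδ
  have herr : |∫ u in (-(h : ℝ))..((τ : ℝ) * ρ), (K u - Poly.eval pw u)| * S ≤
      ((⌈2 * h * (δ : ℚ)⌉ : ℤ) : ℝ) := by
    have hb : ∀ u ∈ Set.uIoc (-(h : ℝ)) (τ * ρ), ‖K u - Poly.eval pw u‖ ≤ (δ : ℝ) / S := by
      intro u hu
      rw [uIoc_of_le hv1] at hu
      rw [Real.norm_eq_abs]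
      exact abs_sub_poly_le_of_tmem hS h0 hW pw (abs_le.2 ⟨hu.1.le, hu.2.trans hv2⟩)
    have h1 := intervalIntegral.norm_integral_le_of_norm_le_const hb
    rw [Real.norm_eq_abs] at h1
    have hlen : |(τ : ℝ) * ρ - -(h : ℝ)| ≤ 2 * h := by rw [abs_le]; constructor <;> linarith
    have hδ0 : 0 ≤ (δ : ℝ) / S :=
      (abs_nonneg _).trans (abs_sub_poly_le_of_tmem hS h0 hW pw (ρ := 0) (by rw [abs_zero]; exact hhr))
    have h2 : |∫ u in (-(h : ℝ))..((τ : ℝ) * ρ), (K u - Poly.eval pw u)| * S ≤ 2 * h * δ := by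
      have := mul_le_mul_of_nonneg_right (h1.trans (mul_le_mul_of_nonneg_left hlen hδ0)) hSr.le
      refine this.trans (le_of_eq ?_)
      field_simp
    refine h2.trans ?_
    have hc := (Rat.cast_le (K := ℝ)).2 (Int.le_ceil (2 * h * (δ : ℚ)))
    push_cast at hc ⊢
    exact hc
  obtain ⟨as, has, e⟩ := tmem_ratPoly S h (partConstPoly h pw τ) ρ hρ
  obtain ⟨bs, hbs, eb⟩ := exists_widen0 has herr ρ
  refine ⟨bs, hbs, ?_⟩
  beta_reduce
  rw [hsplit, eb, ← e]
  beta_reduce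
  rw [eval_partConstPoly]

end Kernel

end PolyMP

end Literature.Analysis.ValidatedNumerics
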